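import Summits.ABC.IUTFork.Cor312PinnedThetaRealSharpNegative
import Summits.ABC.IUTFork.Cor312PilotIdelesPr
import HarnessLib

/-!
# [IUTchIII] Cor. 3.12 — PR-1's Θ-PIN at the PRINT-NORMALISED sharp real setting `Real.settingPrVolSharp`:
# the same kernel NEGATIVE under DH's (Ind2)

PROOF-ONLY sequel (0 definitions, 0 named facts; abc-iut cell, WAVE-4 prover seat abc-iut-w4-d087, gen 4) to
`Cor312PinnedThetaRealSharpNegative` («NEG-PIN-REAL-SHARP»). TAKES NO SIDE on [IUTchIII] Cor. 3.12.

abc-iut-c312-1/c312-7's print-normalised sharp setting `Real.settingPrVolSharp` (`Cor312PilotIdelesPr`, the setting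
branch C's v3 certificate proposes to pin its data to) differs from abc-iut-c312-3's `Real.settingDHVolSharp` ONLY in
the volume weights of the container (`summandPiecesPr` vs `summandPiecesDH`): the log-shells `logShellsDH X logv`, the
field-factor comparison `factorMapDH`, and the Θ-boxes `thetaBoxDH (sharpBoxDH t)` are THE SAME
(`Cor312SettingPrVol.realPiecesPr`). Hence its Θ-regions are literally those of `settingDHVolSharp`
(`thetaRegion_settingPrVolSharp_eq_settingDHVolSharp`, `rfl`), the one-place Dupuy–Hilado mover of the parent file moves its label-`0`
Θ-region at `(0, p₀)` as well, and PR-1's Θ-pin (hρ)+(pΘ) — so also `PinnedRegions`, `PinnedRegions3` — is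
UNSATISFIABLE there for EVERY region-forming operator `ρ` (and `qK`, any columns, ideles, context binders) as soon as
`F` has a tame quadratically ramified place `v₀` over a prime `p₀ ≥ 5` with no place of `S` over `p₀`
(`not_thetaPinned_settingPrVolSharp`, `not_pinnedRegions_settingPrVolSharp`, `not_pinnedRegions3_settingPrVolSharp`).

READING (neutral, as in the parent file): under DH's (Ind2) reading (lattice automorphisms of `I_v`, not isometries)
the idele-box Θ-regions cannot instantiate print's Θ-pin at such `F`; the (Ind2)-stable log-shell lattice boxes are the
pin-compatible reading; under the isometry reading of Ism the mover is absent. For branch C: binding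
`hPin : PinnedRegions(3)` AT `settingPrVolSharp` gives a jointly unsatisfiable hypothesis group at every such `F`
(vacuity guard for v3). HONEST SCOPE: OUR interface + OUR sharp real container; nothing here bears on print's
(xi-e)/(xi-f). [claim: Mochizuki2012, status: disputed]; [cite: DupuyHilado2025, §3.9, §4.9];
[cite: ScholzeStix2018, §2.2 pp. 9–10]. Consumed BY NAME, nothing restated. typed ≠ proved; instantiated ≠ endorsed.
-/

noncomputable section

open Metric Set
open scoped Pointwise

namespace Summit.ABC.IUTFork.Thm311.Real

open Cor312 Cor312Vol Literature.IUT.LogThetaLattice Literature.IUT.LogVolume NumberField IsDedekindDomain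

variable {F : Type} [Field F] [NumberField F] (X : PilotData F)
  (M : Type) [Field M] [NumberField M]
  (archPk : ∀ (j : (thetaIndex X).Label) (vQ : (thetaIndex X).VQ),
    Set ((logShellsDH X (analyticLogv F)).Packet j vQ))
  (archSub : ∀ (j : (thetaIndex X).Label) (v : (thetaIndex X).V),
    Set ((logShellsDH X (analyticLogv F)).Packet j ((thetaIndex X).over v)))
  (Ψ : ℤ → ∀ v : (thetaIndex X).V, v ∈ (thetaIndex X).Vbad → Set ((logShellsDH X (analyticLogv F)).StarPacket v))
  (act : ℤ → ∀ v : (thetaIndex X).V, v ∈ (thetaIndex X).Vbad →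
    (logShellsDH X (analyticLogv F)).StarPacket v →
      Module.End ℚ ((logShellsDH X (analyticLogv F)).StarPacket v))
  (Mmod : ℤ → ∀ j : (thetaIndex X).LabelStar, Set ((logShellsDH X (analyticLogv F)).GlobalPacket j.1))
  (region : ℤ → ∀ j : (thetaIndex X).LabelStar, FinDivisor M → ∀ vQ : (thetaIndex X).VQ,
    Set ((logShellsDH X (analyticLogv F)).Packet j.1 vQ))
  (n : ℤ) {HT : Type} {LogLink : HT → HT → Type} {IsFull : ∀ {s t : HT}, LogLink s t → Prop}
  (lat : LGPGaussianLogThetaLattice LogLink IsFull)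
  {Frd : Type} {IsoF : Frd → Frd → Type} {Ob : Frd → Type} {realify : Frd → Frd} {Strip : Type}
  {IsoS : Strip → Strip → Type} {Mv : ∀ v : (thetaIndex X).V, v ∈ (thetaIndex X).Vbad → Type}
  [∀ v h, Monoid (Mv v h)]
  (sig : GlobalLGPFrobenioidSignature (thetaIndex X).lstar (thetaIndex X).V (· ∈ (thetaIndex X).Vbad)
    Frd IsoF Ob realify Strip IsoS Mv)
  (split : SplittingMonoids Mv) {ObΔ : Type} {N : ∀ v : (thetaIndex X).V, v ∈ (thetaIndex X).Vbad → Type}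
  [∀ v h, Monoid (N v h)] (qData : QPilotData ObΔ N)
  (tq : ∀ (pp : Nat.Primes) (x : (thetaIndex X).Fibre (.inr pp)),
    haveI : Fact (pp : ℕ).Prime := ⟨pp.2⟩; kOf X pp.1 x)
  (t : ∀ (pp : Nat.Primes) (_ : Fin X.lstar) (x : (thetaIndex X).Fibre (.inr pp)),
    haveI : Fact (pp : ℕ).Prime := ⟨pp.2⟩; kOf X pp.1 x)
  (htq0 : ∀ pp x, tq pp x ≠ 0)
  (htq1 : ∀ (pp : Nat.Primes) (x : (thetaIndex X).Fibre (.inr pp)),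
    haveI : Fact (pp : ℕ).Prime := ⟨pp.2⟩; placeOf X pp.1 x ∉ X.S → ‖tq pp x‖ = 1)
  (col : ℤ → Column (logShellsDH X (analyticLogv F)))
  (ρ : (∀ v : (thetaIndex X).V, v ∈ (thetaIndex X).Vbad → Set ((logShellsDH X (analyticLogv F)).StarPacket v)) →
    ∀ (j : (thetaIndex X).Label) (vQ : (thetaIndex X).VQ), Set ((logShellsDH X (analyticLogv F)).Packet j vQ))
  (qK : ∀ v : (thetaIndex X).V, v ∈ (thetaIndex X).Vbad → Set ((logShellsDH X (analyticLogv F)).StarPacket v))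

/-- **The Θ-regions of the print-normalised sharp setting ARE those of the sharp DH setting** (same log-shells, same
comparison, same idele boxes; only the volume weights differ). [folklore] -/
theorem thetaRegion_settingPrVolSharp_eq_settingDHVolSharp (m : ℤ) (j : (thetaIndex X).Label) (vQ : (thetaIndex X).VQ) :
    (settingPrVolSharp X (logvAnalytic_analyticLogv (F := F)) M archPk archSub Ψ act Mmod region n lat sig split qData
        tq t htq0 htq1).thetaRegion m j vQ =
      (settingDHVolSharp X (logvAnalytic_analyticLogv (F := F)) M archPk archSub Ψ act Mmod region n lat sig split
        qData tq t htq0 htq1).thetaRegion m j vQ :=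
  rfl

/-- The one-place Dupuy–Hilado mover of the parent file MOVES the label-`0` Θ-region of `settingPrVolSharp` at `(0, p₀)`,
for every Kummer index `m`, and is the identity on every star packet over a rational place `≠ p₀`.
[cite: DupuyHilado2025, §3.9, §4.9] [claim: Mochizuki2012, status: disputed] -/
theorem exists_ind2_starTrivial_moves_thetaRegion_zero_settingPrVolSharp
    (pp : Nat.Primes) (h5 : 5 ≤ (pp : ℕ)) (v₀ : HeightOneSpectrum (𝓞 F))
    (hv₀ : (thetaIndex X).over (.inr v₀) = .inr pp)
    (he : v₀.asIdeal.ramificationIdx ℤ = 2) (hf : v₀.asIdeal.inertiaDeg ℤ = 1) :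
    ∃ Φ₀ ∈ (logShellsDH X (analyticLogv F)).Ind2Family,
      (∀ v : (thetaIndex X).V, (thetaIndex X).over v ≠ .inr pp →
        (logShellsDH X (analyticLogv F)).starAut Φ₀ v = LinearEquiv.refl ℚ _) ∧
      ∀ m : ℤ, ⇑(Φ₀ 0 (.inr pp)) ''
          (settingPrVolSharp X (logvAnalytic_analyticLogv (F := F)) M archPk archSub Ψ act Mmod region n lat sig
            split qData tq t htq0 htq1).thetaRegion m 0 (.inr pp) ≠
        (settingPrVolSharp X (logvAnalytic_analyticLogv (F := F)) M archPk archSub Ψ act Mmod region n lat sig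
            split qData tq t htq0 htq1).thetaRegion m 0 (.inr pp) := by
  obtain ⟨Φ₀, hΦ₀, hstar, hmov⟩ :=
    exists_ind2_starTrivial_moves_thetaRegion_zero_settingDHVolSharp X M archPk archSub Ψ act Mmod region n lat sig
      split qData tq t htq0 htq1 pp h5 v₀ hv₀ he hf
  refine ⟨Φ₀, hΦ₀, hstar, fun m => ?_⟩
  rw [thetaRegion_settingPrVolSharp_eq_settingDHVolSharp]
  exact hmov m

/-- **PR-1's Θ-PIN FAILS, FOR EVERY region-forming operator `ρ`, at the PRINT-NORMALISED sharp real setting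
`Real.settingPrVolSharp`** as soon as `F` has one tame quadratically ramified place `v₀` (`e = 2`, `f = 1`) over a prime
`p₀ ≥ 5` with NO place of `S` over `p₀`. [cite: DupuyHilado2025, §4.9] [claim: Mochizuki2012, status: disputed] -/
theorem not_thetaPinned_settingPrVolSharp
    (pp : Nat.Primes) (h5 : 5 ≤ (pp : ℕ)) (v₀ : HeightOneSpectrum (𝓞 F))
    (hv₀ : (thetaIndex X).over (.inr v₀) = .inr pp)
    (he : v₀.asIdeal.ramificationIdx ℤ = 2) (hf : v₀.asIdeal.inertiaDeg ℤ = 1)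
    (hS : ∀ v ∈ (thetaIndex X).Vbad, (thetaIndex X).over v ≠ .inr pp) :
    ¬ ThetaPinned
        ({ toSituation := situationPrVol X (logvAnalytic_analyticLogv (F := F)) M archPk archSub Ψ act Mmod region,
           col := col } : LatticeSituation (thetaIndex X))
        (settingPrVolSharp X (logvAnalytic_analyticLogv (F := F)) M archPk archSub Ψ act Mmod region n lat sig
          split qData tq t htq0 htq1) ρ := by
  intro hpin
  obtain ⟨Φ₀, hΦ₀, hstar, hmov⟩ :=
    exists_ind2_starTrivial_moves_thetaRegion_zero_settingPrVolSharp X M archPk archSub Ψ act Mmod region n lat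
      sig split qData tq t htq0 htq1 pp h5 v₀ hv₀ he hf
  refine hmov 0 (Cor312Vol.image_thetaRegion_eq_of_thetaPinned hpin
    (Subgroup.subset_closure (Set.mem_union_right _ hΦ₀)) ?_ 0 0 (.inr pp))
  intro v hv A
  have h := hstar v (hS v hv)
  change ⇑((logShellsDH X (analyticLogv F)).starAut Φ₀ v) '' A = A
  rw [h]
  exact Set.image_id' A

/-- … hence PR-1's `PinnedRegions` fails there for every `ρ`, `qK`. [claim: Mochizuki2012, status: disputed] -/
theorem not_pinnedRegions_settingPrVolSharp
    (pp : Nat.Primes) (h5 : 5 ≤ (pp : ℕ)) (v₀ : HeightOneSpectrum (𝓞 F))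
    (hv₀ : (thetaIndex X).over (.inr v₀) = .inr pp)
    (he : v₀.asIdeal.ramificationIdx ℤ = 2) (hf : v₀.asIdeal.inertiaDeg ℤ = 1)
    (hS : ∀ v ∈ (thetaIndex X).Vbad, (thetaIndex X).over v ≠ .inr pp) :
    ¬ PinnedRegions
        ({ toSituation := situationPrVol X (logvAnalytic_analyticLogv (F := F)) M archPk archSub Ψ act Mmod region,
           col := col } : LatticeSituation (thetaIndex X))
        (settingPrVolSharp X (logvAnalytic_analyticLogv (F := F)) M archPk archSub Ψ act Mmod region n lat sig
          split qData tq t htq0 htq1) ρ qK := fun h =>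
  not_thetaPinned_settingPrVolSharp X M archPk archSub Ψ act Mmod region n lat sig split qData tq t htq0 htq1 col ρ pp
    h5 v₀ hv₀ he hf hS h.1

/-- … and `PinnedRegions3` (two pins ∧ link pin) — branch C's `hPin` binder — AT `settingPrVolSharp`.
[claim: Mochizuki2012, status: disputed] -/
theorem not_pinnedRegions3_settingPrVolSharp
    (pp : Nat.Primes) (h5 : 5 ≤ (pp : ℕ)) (v₀ : HeightOneSpectrum (𝓞 F))
    (hv₀ : (thetaIndex X).over (.inr v₀) = .inr pp)
    (he : v₀.asIdeal.ramificationIdx ℤ = 2) (hf : v₀.asIdeal.inertiaDeg ℤ = 1)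
    (hS : ∀ v ∈ (thetaIndex X).Vbad, (thetaIndex X).over v ≠ .inr pp) :
    ¬ PinnedRegions3
        ({ toSituation := situationPrVol X (logvAnalytic_analyticLogv (F := F)) M archPk archSub Ψ act Mmod region,
           col := col } : LatticeSituation (thetaIndex X))
        (settingPrVolSharp X (logvAnalytic_analyticLogv (F := F)) M archPk archSub Ψ act Mmod region n lat sig
          split qData tq t htq0 htq1) ρ qK := fun h =>
  not_pinnedRegions_settingPrVolSharp X M archPk archSub Ψ act Mmod region n lat sig split qData tq t htq0 htq1 col ρ
    qK pp h5 v₀ hv₀ he hf hS h.1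

/-- The same with the hypothesis in the concrete form `∀ v ∈ S, residueChar F v ≠ p₀`. [claim: Mochizuki2012, status: disputed] -/
theorem not_pinnedRegions3_settingPrVolSharp_of_residueChar_ne
    (pp : Nat.Primes) (h5 : 5 ≤ (pp : ℕ)) (v₀ : HeightOneSpectrum (𝓞 F))
    (hv₀ : (thetaIndex X).over (.inr v₀) = .inr pp)
    (he : v₀.asIdeal.ramificationIdx ℤ = 2) (hf : v₀.asIdeal.inertiaDeg ℤ = 1)
    (hS : ∀ v ∈ X.S, residueChar F v ≠ (pp : ℕ)) :
    ¬ PinnedRegions3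
        ({ toSituation := situationPrVol X (logvAnalytic_analyticLogv (F := F)) M archPk archSub Ψ act Mmod region,
           col := col } : LatticeSituation (thetaIndex X))
        (settingPrVolSharp X (logvAnalytic_analyticLogv (F := F)) M archPk archSub Ψ act Mmod region n lat sig
          split qData tq t htq0 htq1) ρ qK :=
  not_pinnedRegions3_settingPrVolSharp X M archPk archSub Ψ act Mmod region n lat sig split qData tq t htq0 htq1 col ρ
    qK pp h5 v₀ hv₀ he hf (over_ne_of_residueChar_ne X pp hS)

end Summit.ABC.IUTFork.Thm311.Real

end
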